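import Literature.NumberTheory.Automorphic.OpenCellCoinvariants
import Literature.NumberTheory.Automorphic.ParabolicInductionSupportProofs
import Literature.NumberTheory.Automorphic.ParabolicGLExactProofs
import Literature.NumberTheory.Automorphic.ParabolicInductionProofs
import HarnessLib

/-!
# Heredity of Whittaker functionals for `GL_n` (Rodier; Bernstein–Zelevinsky), injection form

Topic `NumberTheory/Automorphic`. Let `F` be a non-archimedean local field, `c : Fin n → α` a
monotone block labelling with standard parabolic `P = P_c = M N`, `σ'` a smooth representation of
`P` trivial on `N = N_c`, and `ψ` a continuous non-trivial additive character, `ψ_U` the standard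
non-degenerate character of `U_n`. We construct an **injective linear map**

* `exists_injective_whittakerFunctionals_smoothIndRep` —
  `whittakerFunctionals (Ind_P^G σ') ψ ↪ leviWhittakerFunctionals c σ' ψ`,

where `leviWhittakerFunctionals c σ' ψ = {l ∈ W^* | l (σ'(w₀ m w₀⁻¹) w) = ψ_U(m) l w, m ∈ A'}`
(`A' = U_n ∩ w₀⁻¹ P w₀`; `w₀ A' w₀⁻¹ = U_n ∩ M` is the maximal unipotent of the Levi and
`m ↦ ψ_U(m)` transported to it is again a non-degenerate character: these are the Whittaker
functionals of the Levi factor `σ'|_M`, block by block, in `w₀`-conjugated coordinates).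

This is the multiplicity-free half of Rodier's heredity theorem
`dim Wh(Ind_P^G σ) = dim Wh_M(σ)` (Rodier 1973; Bernstein–Zelevinsky 1977, Thm. 5.2 and §4.7 for
`GL_n`), which is what the reduction of local multiplicity one to supercuspidal representations
uses. Proof: the Bruhat filtration of `Ind|_{U_n}` by `vanishingOn (cellLT c σ)`; every non-open
cell has an ascent and contributes nothing to `ψ`-twisted coinvariants
(`exists_sub_mem_span_of_ascent`), so a Whittaker functional is determined by its restriction to
`I_open` (`eq_zero_of_forall_cellSection`, induction over the cells in the order `cellKey`); on
`I_open` it factors through the coinvariants `J`, which are spanned by the classes `[Φ_{K₀,w}]`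
(`mk_mem_span_range_mk_cellSection`) subject to `ψ_U(m)[Φ_{K₀,w}] = [Φ_{K₀,σ'(w₀ m w₀⁻¹)w}]`
(`whittakerCharFun_smul_mk_cellSection`). Finally, `rank_whittakerFunctionals_le_one_of_levi` combines the injection with the supercuspidal
support theorem (`bernsteinZelevinsky_support_holds`: `π ↪ i_c σ`) and the exactness of the twisted
Jacquet functor along embeddings (`rank_whittakerFunctionals_le_one_of_injective`): **local
multiplicity one for every irreducible smooth `π` of `GL_n(F)` follows from the rank bound
`rank (leviWhittakerFunctionals c σ' ψ) ≤ 1` for irreducible smooth supercuspidal `σ` of the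
standard Levi subgroups** — the reduction step of Bernstein–Zelevinsky's proof of the
Gelfand–Kazhdan theorem (1976, 5.16–5.21; 1977, §4.7). One definition with body
(`leviWhittakerFunctionals`); no named fact.

## References

* F. Rodier, *Whittaker models for admissible representations of reductive p-adic split groups*,
  Proc. Sympos. Pure Math. 26 (1973), 425–430, Theorem p. 428.
* I. N. Bernstein, A. V. Zelevinsky, *Induced representations of reductive `p`-adic groups I*,
  Ann. Sci. ÉNS 10 (1977), Thm. 2.5, Thm. 5.2, §4.7. [BernsteinZelevinskyASENS1977]
* I. M. Gelfand, D. A. Kazhdan, *Representations of the group GL(n, K) where K is a local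
  field*, in: Lie groups and their representations (Budapest 1971), Halsted 1975, 95–118.
  [GelfandKazhdan1975]
-/

open scoped Pointwise BigOperators
open Matrix OrderDual Topology Cardinal

universe u

namespace Literature.NumberTheory.Automorphic


section Heredity

variable {F : Type*} [Field F] [ValuativeRel F] [TopologicalSpace F] [IsNonarchimedeanLocalField F]
  {n : ℕ} {α : Type*} [LinearOrder α] [Fintype α] (c : Fin n → α)
  {W : Type*} [AddCommGroup W] [Module ℂ W]
  (σ' : Representation ℂ ↥(standardParabolicGL F c) W) (ψ : AddChar F Circle)

/-- **Whittaker functionals of the Levi factor, in `w₀`-conjugated coordinates**: linear forms `l`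
on `W` with `l (σ'(w₀ m w₀⁻¹) w) = ψ_U(m) l w` for all `m ∈ A' = U_n ∩ w₀⁻¹ P_c w₀`. [folklore] -/
def leviWhittakerFunctionals : Submodule ℂ (Module.Dual ℂ W) where
  carrier := {l | ∀ (m : GL (Fin n) F) (hm : m ∈ cellLeviUnipotent (K := F) c) (w : W),
    l (σ' ⟨permGL Fin.revPerm * m * (permGL Fin.revPerm)⁻¹,
      conj_mem_standardParabolicGL_of_mem_cellLeviUnipotent c hm⟩ w) =
      whittakerCharFun ψ ⟨m, cellLeviUnipotent_le c hm⟩ * l w}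
  zero_mem' m hm w := by simp
  add_mem' {l l'} hl hl' m hm w := by
    simp only [Set.mem_setOf_eq, LinearMap.add_apply] at *
    rw [hl m hm, hl' m hm, mul_add]
  smul_mem' a l hl m hm w := by
    simp only [Set.mem_setOf_eq, LinearMap.smul_apply, smul_eq_mul] at *
    rw [hl m hm]
    ring

omit [ValuativeRel F] [TopologicalSpace F] [IsNonarchimedeanLocalField F] [Fintype α] in
/-- Membership in `leviWhittakerFunctionals`. [folklore] -/
lemma mem_leviWhittakerFunctionals_iff (l : Module.Dual ℂ W) :
    l ∈ leviWhittakerFunctionals c σ' ψ ↔ ∀ (m : GL (Fin n) F) (hm : m ∈ cellLeviUnipotent (K := F) c) (w : W),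
      l (σ' ⟨permGL Fin.revPerm * m * (permGL Fin.revPerm)⁻¹,
        conj_mem_standardParabolicGL_of_mem_cellLeviUnipotent c hm⟩ w) =
        whittakerCharFun ψ ⟨m, cellLeviUnipotent_le c hm⟩ * l w :=
  Iff.rfl

variable {c σ'}

omit [Fintype α] in
/-- **A compact open subgroup of `N'` on which `ψ_U` is trivial.** [folklore] -/
lemma exists_compactOpen_subgroup_whittakerChar_eq_one (hc : Monotone c) (hψ : Continuous ψ) :
    ∃ K₀ : Subgroup ↥(oppositeCellRadical (K := F) c), IsOpen (K₀ : Set ↥(oppositeCellRadical (K := F) c)) ∧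
      IsCompact (K₀ : Set ↥(oppositeCellRadical (K := F) c)) ∧
      ∀ x ∈ K₀, whittakerCharFun ψ (radicalToUpper hc x) = 1 := by
  haveI : T2Space F := (GaloisRepresentations.IsNonarchimedeanLocalField.isLocalField F).toT2Space
  obtain ⟨Uj, hUjo, hUjc, -⟩ := isLimitOfCompactOpen_upperUnitriangular (F := F) (n := n) ∅ isCompact_empty
  refine ⟨(Uj ⊓ (whittakerChar (n := n) ψ).ker).comap (radicalToUpper hc), ?_, ?_, fun x hx => ?_⟩
  · exact (hUjo.inter (isOpen_ker_whittakerChar hψ)).preimage (continuous_radicalToUpper hc)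
  · refine (isCompact_preimage_radicalToUpper hc hUjc).of_isClosed_subset ?_ fun x hx => hx.1
    exact ((hUjc.isClosed).inter ((whittakerChar (n := n) ψ).ker.isClosed_of_isOpen
      (isOpen_ker_whittakerChar hψ))).preimage (continuous_radicalToUpper hc)
  · exact (mem_ker_whittakerChar_iff ψ _).1 hx.2

/-- A Whittaker functional of `Ind_P^G σ'` restricted to `I_open` factors through the coinvariants
`J = (I_open)_{U_n,ψ}`. [folklore] -/
noncomputable def whittakerFunctionalLift
    (l : ↥(whittakerFunctionals (Representation.smoothIndRep (standardParabolicGL F c) σ') ψ)) :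
    (openCellSubrep c σ' ψ).toRepresentation.Coinvariants →ₗ[ℂ] ℂ :=
  Representation.Coinvariants.lift _ ((l : Module.Dual ℂ _) ∘ₗ (openCellSubrep c σ' ψ).toSubmodule.subtype)
    fun u => LinearMap.ext fun x => by
      rw [LinearMap.comp_apply, LinearMap.comp_apply, LinearMap.comp_apply, Submodule.subtype_apply,
        Submodule.subtype_apply]
      change (l : Module.Dual ℂ _) (whittakerTwist (Representation.smoothIndRep (standardParabolicGL F c) σ') ψ u
        (x : Representation.SmoothInd (standardParabolicGL F c) σ')) = _
      have e : (l : Module.Dual ℂ _) (Representation.smoothIndRep (standardParabolicGL F c) σ' (u : GL (Fin n) F)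
          (x : Representation.SmoothInd (standardParabolicGL F c) σ')) =
          whittakerCharFun ψ u * (l : Module.Dual ℂ _) (x : Representation.SmoothInd (standardParabolicGL F c) σ') :=
        l.2 u _
      rw [whittakerTwist_apply, map_smul, e, smul_eq_mul, inv_mul_cancel_left₀ (whittakerCharFun_ne_zero ψ u)]

/-- `l̄ [x] = l x`. [folklore] -/
@[simp] lemma whittakerFunctionalLift_mk
    (l : ↥(whittakerFunctionals (Representation.smoothIndRep (standardParabolicGL F c) σ') ψ))
    (x : ↥(openCellSubrep c σ' ψ).toSubmodule) :
    whittakerFunctionalLift ψ l (Representation.Coinvariants.mk _ x) =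
      (l : Module.Dual ℂ (Representation.SmoothInd (standardParabolicGL F c) σ'))
        (x : Representation.SmoothInd (standardParabolicGL F c) σ') :=
  rfl

/-- **The Levi relation**: `l (Φ_{K₀, σ'(w₀ m w₀⁻¹) w}) = ψ_U(m) l (Φ_{K₀,w})` for a Whittaker
functional `l` of `Ind_P^G σ'`. [folklore] -/
theorem whittakerFunctional_cellSection_levi (hc : Monotone c) (hσ' : σ'.IsSmooth) (hψ : Continuous ψ)
    (K₀ : Subgroup ↥(oppositeCellRadical (K := F) c)) (hK₀o : IsOpen (K₀ : Set ↥(oppositeCellRadical (K := F) c)))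
    (hK₀c : IsCompact (K₀ : Set ↥(oppositeCellRadical (K := F) c)))
    (hK₀θ : ∀ x ∈ K₀, whittakerCharFun ψ (radicalToUpper hc x) = 1)
    (l : ↥(whittakerFunctionals (Representation.smoothIndRep (standardParabolicGL F c) σ') ψ))
    {m : GL (Fin n) F} (hm : m ∈ cellLeviUnipotent (K := F) c) (w : W) :
    (l : Module.Dual ℂ _) (cellSection σ' hc hσ' K₀ hK₀o hK₀c (σ' ⟨permGL Fin.revPerm * m * (permGL Fin.revPerm)⁻¹,
        conj_mem_standardParabolicGL_of_mem_cellLeviUnipotent c hm⟩ w)) =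
      whittakerCharFun ψ ⟨m, cellLeviUnipotent_le c hm⟩ * (l : Module.Dual ℂ _) (cellSection σ' hc hσ' K₀ hK₀o hK₀c w) := by
  have h := congrArg (whittakerFunctionalLift ψ l)
    (whittakerCharFun_smul_mk_cellSection (σ' := σ') ψ hc hσ' hψ K₀ hK₀o hK₀c hK₀θ hm w)
  rw [map_smul, whittakerFunctionalLift_mk, whittakerFunctionalLift_mk, smul_eq_mul] at h
  exact h.symm

/-- A Whittaker functional killing all `Φ_{K₀,w}` kills `I_open`. [folklore] -/
theorem whittakerFunctional_eq_zero_on_open (hc : Monotone c) (hσ' : σ'.IsSmooth)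
    (K₀ : Subgroup ↥(oppositeCellRadical (K := F) c)) (hK₀o : IsOpen (K₀ : Set ↥(oppositeCellRadical (K := F) c)))
    (hK₀c : IsCompact (K₀ : Set ↥(oppositeCellRadical (K := F) c)))
    (hK₀θ : ∀ x ∈ K₀, whittakerCharFun ψ (radicalToUpper hc x) = 1)
    (l : ↥(whittakerFunctionals (Representation.smoothIndRep (standardParabolicGL F c) σ') ψ))
    (hl : ∀ w, (l : Module.Dual ℂ _) (cellSection σ' hc hσ' K₀ hK₀o hK₀c w) = 0)
    (f : Representation.SmoothInd (standardParabolicGL F c) σ')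
    (hf : f ∈ vanishingOn (standardParabolicGL F c) σ' (cellLT (K := F) c Fin.revPerm)) :
    (l : Module.Dual ℂ _) f = 0 := by
  have hmem := mk_mem_span_range_mk_cellSection (σ' := σ') ψ hc hσ' K₀ hK₀o hK₀c hK₀θ f hf
  have hle : Submodule.span ℂ (Set.range fun w => Representation.Coinvariants.mk (openCellSubrep c σ' ψ).toRepresentation
      ⟨cellSection σ' hc hσ' K₀ hK₀o hK₀c w, cellSection_mem_vanishingOn σ' hc hσ' K₀ hK₀o hK₀c w⟩) ≤
      LinearMap.ker (whittakerFunctionalLift ψ l) := by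
    rw [Submodule.span_le]
    rintro _ ⟨w, rfl⟩
    rw [SetLike.mem_coe, LinearMap.mem_ker, whittakerFunctionalLift_mk]
    exact hl w
  have := hle hmem
  rw [LinearMap.mem_ker, whittakerFunctionalLift_mk] at this
  exact this

omit [Fintype α] in
/-- A Whittaker functional kills the differences `x - ψ_U(u)⁻¹ u·x`. [folklore] -/
lemma whittakerFunctional_apply_sub_whittakerTwist
    (l : ↥(whittakerFunctionals (Representation.smoothIndRep (standardParabolicGL F c) σ') ψ))
    (u : ↥(upperUnitriangular (Fin n) F)) (x : Representation.SmoothInd (standardParabolicGL F c) σ') :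
    (l : Module.Dual ℂ _) (x - whittakerTwist (Representation.smoothIndRep (standardParabolicGL F c) σ') ψ u x) = 0 := by
  have e : (l : Module.Dual ℂ _) (Representation.smoothIndRep (standardParabolicGL F c) σ' (u : GL (Fin n) F) x) =
      whittakerCharFun ψ u * (l : Module.Dual ℂ _) x := l.2 u x
  rw [map_sub, whittakerTwist_apply, map_smul, e, smul_eq_mul,
    inv_mul_cancel_left₀ (whittakerCharFun_ne_zero ψ u), sub_self]

omit [ValuativeRel F] [TopologicalSpace F] [IsNonarchimedeanLocalField F] in
/-- **Successor cell**: if the cell of `σ` is not the open one, `cellLE c σ = cellLT c τ` for some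
`τ` with a larger key. [folklore] -/
lemma exists_cellLE_eq_cellLT {σ : Equiv.Perm (Fin n)}
    (h : cellKey c σ < cellKey c (Fin.revPerm : Equiv.Perm (Fin n))) :
    ∃ τ : Equiv.Perm (Fin n), cellKey c σ < cellKey c τ ∧ cellLE (K := F) c σ = cellLT (K := F) c τ := by
  classical
  obtain ⟨τ, hτ, hmin⟩ := (Finset.univ.filter fun τ : Equiv.Perm (Fin n) => cellKey c σ < cellKey c τ).exists_min_image
    (cellKey c) ⟨Fin.revPerm, Finset.mem_filter.2 ⟨Finset.mem_univ _, h⟩⟩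
  have hτ' := (Finset.mem_filter.1 hτ).2
  refine ⟨τ, hτ', Set.ext fun g => ?_⟩
  simp only [cellLE, cellLT, mem_cellsBelow_iff, Set.mem_Iic, Set.mem_Iio]
  constructor
  · rintro ⟨ρ, hρ, hg⟩
    exact ⟨ρ, lt_of_le_of_lt hρ hτ', hg⟩
  · rintro ⟨ρ, hρ, hg⟩
    refine ⟨ρ, ?_, hg⟩
    by_contra hlt
    exact absurd (hmin ρ (Finset.mem_filter.2 ⟨Finset.mem_univ _, not_le.1 hlt⟩)) (not_le.2 hρ)

/-- **A Whittaker functional of `Ind_P^G σ'` vanishing on `I_open` vanishes** (induction over the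
Bruhat cells: non-open cells have an ascent and contribute no `ψ`-coinvariants).
[cite: BernsteinZelevinskyASENS1977, Thm. 5.2] -/
theorem whittakerFunctional_eq_zero_of_eq_zero_on_open (hc : Monotone c)
    (hN : ∀ p : ↥(standardParabolicGL F c), (p : GL (Fin n) F) ∈ unipotentRadicalGL F c → σ' p = 1)
    (hψ : ψ.IsContinuousNontrivial)
    (l : ↥(whittakerFunctionals (Representation.smoothIndRep (standardParabolicGL F c) σ') ψ))
    (hl : ∀ f ∈ vanishingOn (standardParabolicGL F c) σ' (cellLT (K := F) c Fin.revPerm), (l : Module.Dual ℂ _) f = 0) :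
    l = 0 := by
  classical
  -- `T σ`: `l` kills `vanishingOn (cellLT σ)`; by induction on the number of larger keys
  have key : ∀ (N : ℕ) (σ : Equiv.Perm (Fin n)),
      (Finset.univ.filter fun τ : Equiv.Perm (Fin n) => cellKey c σ < cellKey c τ).card = N →
      ∀ f ∈ vanishingOn (standardParabolicGL F c) σ' (cellLT (K := F) c σ), (l : Module.Dual ℂ _) f = 0 := by
    intro N
    induction N using Nat.strong_induction_on with
    | _ N ih =>
      intro σ hcardN f hf
      rcases (cellKey_le_cellKey_rev c hc σ).lt_or_eq with hlt | heq
      · -- an ascent, then pass to the successor cell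
        have hasc : ∃ i : Fin n, ∃ h : (i : ℕ) + 1 < n, c (σ.symm i) < c (σ.symm ⟨(i : ℕ) + 1, h⟩) := by
          rcases exists_lt_or_parabolicDoubleCoset_eq_rev (K := F) c hc σ with h | h
          · exact h
          · exact absurd ((cellKey_eq_iff (K := F) c).2 h) hlt.ne
        obtain ⟨i, hi, hci⟩ := hasc
        obtain ⟨f', hf', hff'⟩ := exists_sub_mem_span_of_ascent c σ' ψ hc hi hci hN hψ f hf
        obtain ⟨τ, hστ, hLE⟩ := exists_cellLE_eq_cellLT (F := F) (c := c) hlt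
        have hl' : (l : Module.Dual ℂ _) f' = 0 := by
          refine ih _ ?_ τ rfl f' (hLE ▸ hf')
          rw [← hcardN]
          apply Finset.card_lt_card
          refine ⟨fun ρ hρ => Finset.mem_filter.2 ⟨Finset.mem_univ _,
            hστ.trans (Finset.mem_filter.1 hρ).2⟩, fun hsub => ?_⟩
          have := (Finset.mem_filter.1 (hsub (Finset.mem_filter.2 ⟨Finset.mem_univ _, hστ⟩))).2
          exact lt_irrefl _ this
        have hspan : (l : Module.Dual ℂ _) (f - f') = 0 := by
          refine Submodule.span_induction (p := fun y _ => (l : Module.Dual ℂ _) y = 0) ?_ (map_zero _) ?_ ?_ hff'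
          · rintro _ ⟨u, x, -, rfl⟩
            exact whittakerFunctional_apply_sub_whittakerTwist ψ l u x
          · intro x y _ _ hx hy
            rw [map_add, hx, hy, add_zero]
          · intro a x _ hx
            rw [map_smul, hx, smul_zero]
        rw [map_sub, hl', sub_zero] at hspan
        exact hspan
      · -- the open cell itself
        have hcell : cellLT (K := F) c σ = cellLT (K := F) c Fin.revPerm := by
          simp only [cellLT, heq]
        exact hl f (hcell ▸ hf)
  -- the minimal cell: `cellLT σ_min = ∅`
  obtain ⟨σ₀, -, hmin⟩ := Finset.univ.exists_min_image (cellKey c) (Finset.univ_nonempty (α := Equiv.Perm (Fin n)))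
  have hempty : cellLT (K := F) c σ₀ = ∅ :=
    cellLT_eq_empty c fun ⟨τ, hτ⟩ => absurd (hmin τ (Finset.mem_univ _)) (not_le.2 hτ)
  apply Subtype.ext
  refine LinearMap.ext fun f => ?_
  have := key _ σ₀ rfl f (by rw [hempty, vanishingOn_empty]; trivial)
  simpa using this

/-- **Heredity, injection form** (Rodier; Bernstein–Zelevinsky): for `σ'` smooth and trivial on
`N_c` and `ψ` continuous non-trivial there is an injective linear map from the Whittaker
functionals of `Ind_{P_c}^{GL_n} σ'` to the Levi Whittaker functionals of `σ'`.
[cite: BernsteinZelevinskyASENS1977, Thm. 5.2, §4.7] -/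
theorem exists_injective_whittakerFunctionals_smoothIndRep (hc : Monotone c) (hσ' : σ'.IsSmooth)
    (hN : ∀ p : ↥(standardParabolicGL F c), (p : GL (Fin n) F) ∈ unipotentRadicalGL F c → σ' p = 1)
    (hψ : ψ.IsContinuousNontrivial) :
    ∃ Λ : ↥(whittakerFunctionals (Representation.smoothIndRep (standardParabolicGL F c) σ') ψ) →ₗ[ℂ]
        ↥(leviWhittakerFunctionals c σ' ψ), Function.Injective Λ := by
  obtain ⟨K₀, hK₀o, hK₀c, hK₀θ⟩ := exists_compactOpen_subgroup_whittakerChar_eq_one (F := F) (c := c) ψ hc hψ.1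
  -- `Λ₀ l = l ∘ Φ_{K₀,·}`
  let Λ₀ : ↥(whittakerFunctionals (Representation.smoothIndRep (standardParabolicGL F c) σ') ψ) →ₗ[ℂ] Module.Dual ℂ W :=
    (LinearMap.lcomp ℂ ℂ (cellSectionₗ σ' hc hσ' K₀ hK₀o hK₀c)).comp
      (whittakerFunctionals (Representation.smoothIndRep (standardParabolicGL F c) σ') ψ).subtype
  have hΛ₀ : ∀ l w, Λ₀ l w = (l : Module.Dual ℂ _) (cellSection σ' hc hσ' K₀ hK₀o hK₀c w) := fun l w => rfl
  have hmem : ∀ l, Λ₀ l ∈ leviWhittakerFunctionals c σ' ψ := fun l =>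
    (mem_leviWhittakerFunctionals_iff c σ' ψ _).2 fun m hm w => by
      rw [hΛ₀, hΛ₀]
      exact whittakerFunctional_cellSection_levi ψ hc hσ' hψ.1 K₀ hK₀o hK₀c hK₀θ l hm w
  refine ⟨Λ₀.codRestrict _ hmem, fun l l' hll' => ?_⟩
  have hΛ : Λ₀ l = Λ₀ l' := congrArg Subtype.val hll'
  rw [← sub_eq_zero]
  refine whittakerFunctional_eq_zero_of_eq_zero_on_open ψ hc hN hψ (l - l') fun f hf => ?_
  refine whittakerFunctional_eq_zero_on_open ψ hc hσ' K₀ hK₀o hK₀c hK₀θ (l - l') (fun w => ?_) f hf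
  have := congrArg (fun L : Module.Dual ℂ W => L w) hΛ
  simp only [hΛ₀] at this
  rw [Submodule.coe_sub, LinearMap.sub_apply, sub_eq_zero]
  exact this

end Heredity


section Reduction

variable {F : Type u} [Field F] [ValuativeRel F] [TopologicalSpace F] [IsNonarchimedeanLocalField F]
  {n : ℕ} {V : Type*} [AddCommGroup V] [Module ℂ V]
  (π : Representation ℂ (GL (Fin n) F) V) (ψ : AddChar F Circle)

/-- The inducing datum `σ' = (σ ∘ proj) ⊗ δ^{1/2}` of `i_c σ` is trivial on `N_c`. [folklore] -/
lemma twist_comp_leviProjection_eq_one_of_mem {r : ℕ} (c : Fin n → Fin r)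
    {W : Type*} [AddCommGroup W] [Module ℂ W] (σ : Representation ℂ (Π a, GL {i // c i = a} F) W)
    (p : ↥(standardParabolicGL F c)) (hp : (p : GL (Fin n) F) ∈ unipotentRadicalGL F c) :
    Representation.twist (σ.comp (leviProjection F c)) (rootDeltaChar (standardParabolicGL F c)) p = 1 := by
  have hp' : p ∈ unipotentRadicalP F c := by
    obtain ⟨q, hq, hqp⟩ := hp
    have : q = p := Subtype.ext hqp
    exact this ▸ hq
  apply LinearMap.ext
  intro w
  rw [Representation.twist_apply, rootDeltaChar_eq_one_of_mem_unipotentRadicalP F c hp', Units.val_one, one_smul,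
    MonoidHom.comp_apply]
  have : leviProjection F c p = 1 := hp'
  rw [this, map_one]

/-- **Local multiplicity one for `GL_n`, reduction to the supercuspidal support.** If (for the
given non-trivial continuous `ψ`) for every
monotone surjective block labelling `c : Fin n → Fin r` and every irreducible smooth supercuspidal
representation `σ` of the standard Levi `Π_a GL_{n_a}(F)` (spaces in the universe of `F`) the
Levi Whittaker functionals of the inducing datum `σ ∘ proj ⊗ δ^{1/2}` have rank `≤ 1`, then every
irreducible smooth representation of `GL_n(F)` has a space of `ψ`-Whittaker functionals of rank
`≤ 1`. (Bernstein–Zelevinsky 1977, §4.7: `π ↪ i_c σ`, exactness of `r_{U,θ}`, heredity.)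
[cite: BernsteinZelevinskyASENS1977, Thm. 2.5, §4.7] -/
theorem rank_whittakerFunctionals_le_one_of_levi
    (h : ψ.IsContinuousNontrivial → ∀ (r : ℕ) (c : Fin n → Fin r), Monotone c → Function.Surjective c →
      ∀ (W : Type u) [AddCommGroup W] [Module ℂ W] (σ : Representation ℂ (Π a, GL {i // c i = a} F) W),
        σ.IsIrreducible → σ.IsSmooth → σ.IsSupercuspidal →
        Module.rank ℂ ↥(leviWhittakerFunctionals c
          (Representation.twist (σ.comp (leviProjection F c)) (rootDeltaChar (standardParabolicGL F c))) ψ) ≤ 1) :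
    rank_whittakerFunctionals_le_one π ψ := by
  intro _ hπ hψ
  obtain ⟨r, c, hc, hsurj, W, _, _, σ, hirr, hσ, hcusp, f, hf⟩ := bernsteinZelevinsky_support_holds F (n := n) (V := V) π hπ
  have h₂ : (Representation.parabolicIndGL F c σ).IsSmooth := Representation.isSmooth_smoothInd _ _
  refine rank_whittakerFunctionals_le_one_of_injective ψ h₂ hψ.1 f hf ?_
  change Module.rank ℂ ↥(whittakerFunctionals (Representation.smoothIndRep (standardParabolicGL F c)
    (Representation.twist (σ.comp (leviProjection F c)) (rootDeltaChar (standardParabolicGL F c)))) ψ) ≤ 1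
  -- heredity: `Wh(i_c σ) ↪ leviWhittakerFunctionals`
  obtain ⟨Λ, hΛ⟩ := exists_injective_whittakerFunctionals_smoothIndRep (F := F) (c := c)
    (σ' := Representation.twist (σ.comp (leviProjection F c)) (rootDeltaChar (standardParabolicGL F c)))
    ψ hc (hσ.twist_comp_leviProjection F c) (fun p hp => twist_comp_leviProjection_eq_one_of_mem c σ p hp) hψ
  have hrank := LinearMap.lift_rank_le_of_injective Λ hΛ
  have hle := h hψ r c hc hsurj W σ hirr hσ hcusp
  rw [← Cardinal.lift_le_one_iff.{_, u}] at hle ⊢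
  simpa using hrank.trans hle

end Reduction

end Literature.NumberTheory.Automorphic
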